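import Mathlib.Analysis.SpecialFunctions.Pow.Real
import Mathlib.Analysis.InnerProductSpace.PiL2
import Mathlib.Data.Set.Card
import Literature.MathematicalPhysics.QuantumLattice.AnisotropicSectors
import HarnessLib

/-!
# BGM 2006 Appendix A1–A3: the ultraviolet integration, the four-sector count (proof of Lemma 3.1),
# the Sector Counting Lemma A3.1 — statements, typed; sector / constraint-function vocabulary

G. Benfatto, A. Giuliani, V. Mastropietro, *Fermi liquid behavior in the 2D Hubbard model at low
temperatures*, Ann. Henri Poincaré **7** (2006) 809–898 = arXiv:cond-mat/0507686, Appendix A1–A3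
[cite: BenfattoGiulianiMastropietro2006, App. A1-A3]. Typer wave gate-hubbard-kl (D-0069 (2)), seat t2, file
F2c of HOME/DAG.tsv: rows BGM06.A1 (FACT-LIST F-010), BGM06.A2 (TREE), BGM06.A3.1 (FACT-LIST F-011), aid
BGM06.A4 (out of the director's scope; docstring only). LOCATORS `pNNNN:Ln` = chunk:line of the `lit read`
render of the arXiv TeX; equation / lemma numbers are the TeX labels.

## Typing level

As in `BGM2006Sec3Flow.lean` (companion, same seat): PREDICATES with explicit constants, nothing asserted.
Here the objects are geometric and can be carried concretely: the ANISOTROPIC / ISOTROPIC sector index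
sets `O_h`, `Ō_h` and their nesting `≺` are the tree's dyadic circle partition (`AngularSectors`:
`sectorCount`, `sectorIndex_div_pow`, `card_filter_div_eq`), the s-sectors `S_{h,ω}` (2.69) are typed as
SETS in `ℝ²` for an arbitrary family `eps : ℤ → (ℝ²→ℝ)` of scale-`h` effective dispersion relations
`ε_h` (the intended instance: BGM's `ε_h` of (2.36c), which satisfies Lemma 2.1 under (2.36); the angular
partition is the tree's `sectorWeightCirc`, one admissible choice of the `ζ_{h,ω}` of (2.45)/(2.57)), the
constraint function `χ` (2.73)/(2.84a)/(3.16) is the proposition "there are momenta in the prescribed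
s-sectors with `Σ ε(f) k(f) = 0`", and Lemma A3.1 is a predicate on `(γ, e₀, μ, eps)` and the constant `c`.
The ultraviolet statements of App. A1 are typed on scale-indexed numerical data (the weighted `L¹` norms
that (2.16)/(A1.6) bound), with the `k₀`-slice cutoffs `h_n` (A1.2) carried concretely by the tree's
Gallavotti–Nicolò cutoffs (`ScaleCutoffs`: `gnCutoff = H₀`, `gnShell`).

## App. A2 = proof of Lemma 3.1 — TREE, cited not restated (row BGM06.A2; DECOMP F.0)

App. A2 (p0035:L114–p0036:L143) bounds `|A_h(ω̄₁; ω̄₂,ω̄₃,ω̄₄)| ≤ Cγ^{−h}|h|` (A2.0), `A_h` = the set of triples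
of ISOTROPIC scale-`h` sectors such that momenta `k_i ∈ S̄_{h,ω̄_i}` with `Σ_{i=1}^4 k_i = 0` exist (typed
below: `isoQuadruples`), by: reordering (A2.2)–(A2.3) (factor 3); the near-collinear part
`|φ_{1,2}| ≤ πκ₀γ^{h/2}` counted directly, `|𝒜_<(κ₀)| ≤ 16κ₀²γ^{−h}` (A2.4)–(A2.5); the transversal part by
Dini's theorem on `r⃗ = f⃗(n⃗) = γ^{−h}Σ_{i=1,2}[p_F^{(h)}(θ_i+πn_iγ^h) − p_F^{(h)}(θ_i)]` (A2.6)–(A2.13) with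
`‖A‖ ≍ 1/|sin(θ₁−θ₂)|` (A2.11), `κ₀² ≥ 2cRC₂²` (A2.13), giving `ω̄₃` in `≤ 4C₂R|sin(kπγ^h)|` ways and `ω̄₄` in
`≤ 8`, whence `|𝒜_>| ≤ 2Σ_{k=[κ₀γ^{−h/2}]}^{[γ^{−h}/2]} 16C₂R/(kγ^h) ≤ [16C₂R log γ]γ^{−h}|h|` (A2.14). The tree
PROVES this counting scheme, reorganised into one-dimensional fibrations, for the FREE band Fermi curve at
every level `μ` in a compact of `(−4,0)` (tree convention):
`Literature.MathematicalPhysics.QuantumLattice.count_pairs_exists` (module `HubbardBandSectorCountingCounts`;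
toolbox `gridCount_L2…L5`, `pair_close_L2…L5`, `card_prod3_le`, band bounds `BandBounds`):
`#{(a,c) : |h_μ(θ₁;θ_a,θ_c)| ≤ C_δ w} ≤ K_p(J+2+log N)/w` on grids `Nw = 2π`, `2^J w = π` — with the isotropic
width `w = πγ^h` this is `≤ K'γ^{−h}(1+|h|)`, i.e. (A2.0) in `h = 0`-safe form (the printed `|h|` vanishes at
`h = 0`). NOT covered by the tree theorem (GAP candidate, reported on STATUS): (A2.0) is printed for the
INTERACTING scale-`h` curve `p_F^{(h)}` (C², convex uniformly in `h`, Lemma 2.1), the tree counts on `ε₀`.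

## App. A4 (aid row BGM06.A4; outside the wave scope, no licence)

Lemma A4.1 (p0038:L75–83): for `h' ≤ h ≤ 0`, `L ≥ 4`, `1 ≤ F ≤ L−1`, with `F` scale-`h'` sectors fixed,
`Σ_{Ω^{(h')}_{L−F} ≺ Ω^{(h)}_{L−F}} χ(Ω_L^{(h')}) ≤ c^L γ^{½(h−h')(L−F−1)}` (A4.2) — "a simple consequence of momentum
conservation"; and (A4.1) `Σ_{ω₁∈O_h} χ(Ω₄) ≤ c`. App. A4 then proves Lemma 2.4 (t2's file F2a). Recorded here
for the locator only; not typed (W-002 scope rule).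
-/

noncomputable section

open Finset

namespace Literature.MathematicalPhysics.QuantumLattice.FermiRG

namespace BGM2006AppA

/-! ### Sector indices at scale `h ≤ 0` (γ = 4): anisotropic `O_h`, isotropic `Ō_h`, nesting `≺` -/

/-- The tree's dyadic index `n = −h` of a scale `h ≤ 0` (`AngularSectors`, `ScaleCutoffs` use `n`). [folklore] -/
def scaleIdx (h : ℤ) : ℕ := (-h).toNat

/-- **`|O_h|`, the number of ANISOTROPIC sectors at scale `h`** (§2.5 (2.45) p0010:L28: "`ω` an integer in the
set `O_h = {0, 1, …, γ^{−(h−1)/2} − 1}` (recall that `γ = 4`)", angular width `πγ^{h/2}`): `2^{n+1} = γ^{(1−h)/2}`,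
the tree's `sectorCount n`, `n = −h`. [cite: BenfattoGiulianiMastropietro2006, §2.5 (2.45) p0010:L28] -/
def anisoCount (h : ℤ) : ℕ := sectorCount (scaleIdx h)

/-- **`|Ō_h|`, the number of ISOTROPIC sectors at scale `h`** (§2.5 (2.57) p0011:L110: angles
`θ̄_{h,ω̄} = (ω̄+½)πγ^h`, angular width `πγ^h`): the tree's `sectorCount (2n) = 2·4ⁿ`, `n = −h` — the number of
arcs of width `π4^{−n}` tiling the circle (print: "`Ō_h = {0,1,…,γ^{−(h−1)}−1}`", i.e. `4^{n+1}`, twice the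
tiling count; the tree's `IsotropicSectors` records the same discrepancy; the COUNT used in the bounds of
App. A2 is `≍ γ^{−h}` either way). [cite: BenfattoGiulianiMastropietro2006, §2.5 (2.57) p0011:L110] -/
def isoCount (h : ℤ) : ℕ := sectorCount (2 * scaleIdx h)

/-- **Nesting `≺` of anisotropic sectors** (after (2.69) p0014:L75: "`S_{h+1,ω} ⊇ S_{h,2ω} ∪ S_{h,2ω+1}` …
`S_{h,2ω}` and `S_{h,2ω+1}` are the two only sectors on scale `h` strictly contained into `S_{h+1,ω}`"; after
(2.88) p0016:L110: "`Ω^{(h)} ≺ Ω^{(h₀)}` means … `S_{j_f^{(h)},ω_f^{(h)}} ⊂ S_{j_f^{(h₀)},ω_f^{(h₀)}}`"): the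
scale-`h'` index `ω'` refines the scale-`h` index `ω` (`h' ≤ h`) iff `ω' / 2^{n'−n} = ω` — the tree's
`sectorIndex_div_pow`; exactly `2^{n'−n} = γ^{(h−h')/2}` fine indices refine a coarse one
(`card_filter_div_eq`, App. A3 p0037:L13 "exactly `γ^{½(h−h')}` s-sectors on scale `h'`").
[cite: BenfattoGiulianiMastropietro2006, §2.7 (2.69) p0014:L75] -/
def Refines (h' h : ℤ) (ω' ω : ℕ) : Prop :=
  h' ≤ h ∧ ω' / 2 ^ (scaleIdx h' - scaleIdx h) = ω

/-- **Nesting of an isotropic sector in an anisotropic one of the same scale** (§3.1 p0022:L57–58: "our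
definitions are such that any isotropic sector is strictly contained in one anisotropic sector"; (3.28)
`ω̄₁ ≺ ω(f₁)`): `ω̄ / 2ⁿ = ω` (`2ⁿ = γ^{−h/2}` isotropic arcs of width `πγ^h` per anisotropic arc of width
`πγ^{h/2}`). [cite: BenfattoGiulianiMastropietro2006, §3.1 (3.28) p0022:L57] -/
def IsoRefines (h : ℤ) (ωbar ω : ℕ) : Prop :=
  ωbar / 2 ^ scaleIdx h = ω

/-! ### s-sectors (2.69) and the constraint function `χ` (2.73)/(2.84a)/(3.16) -/

/-- **The anisotropic s-sector `S_{h,ω}`** of (2.69) p0014:L66–70: "`S_{h,ω} = {k⃗ = ρe_r(θ) ∈ ℝ² :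
|ε_h(k⃗) − μ| ≤ γ^h e₀, ζ_{h,ω}(θ) ≠ 0}`", for a family `eps h = ε_h` of scale-`h` dispersion relations
((2.36c); the intended instance satisfies Lemma 2.1) and the tree's smooth angular partition
`ζ_{h,ω} = sectorWeightCirc n ω` (width `π/2ⁿ = πγ^{h/2}`, one admissible choice of (2.45)) composed with the
polar angle. [cite: BenfattoGiulianiMastropietro2006, §2.7 (2.69) p0014:L66] -/
def sSector (γ e₀ μ : ℝ) (eps : ℤ → (Fin 2 → ℝ) → ℝ) (h : ℤ) (ω : ℕ) : Set (Fin 2 → ℝ) :=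
  {k | |eps h k - μ| ≤ γ ^ h * e₀ ∧ sectorWeightCirc (scaleIdx h) (ω : ℤ) (polarAngle k) ≠ 0}

/-- **The isotropic s-sector `S̄_{h,ω̄}`** (App. A2 p0035:L116–120: "given an isotropic sector index of scale
`h`, `ω̄ ∈ Ō_h`, let us call `S̄_{h,ω̄}` the corresponding isotropic s-sector"; (2.57): `ζ̄_{h,ω̄}` of width
`πγ^h`): as `sSector` with the angular index `2n` (`sectorWeightCirc (2n)`, width `π4^{−n} = πγ^h`, the tree's
`isotropicCutoff` convention). [cite: BenfattoGiulianiMastropietro2006, App. A2 p0035:L116] -/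
def sSectorIso (γ e₀ μ : ℝ) (eps : ℤ → (Fin 2 → ℝ) → ℝ) (h : ℤ) (ωbar : ℕ) : Set (Fin 2 → ℝ) :=
  {k | |eps h k - μ| ≤ γ ^ h * e₀ ∧ sectorWeightCirc (2 * scaleIdx h) (ωbar : ℤ) (polarAngle k) ≠ 0}

/-- **A sector label of a field `f`**: its scale `h(f)` (or `j_f`), whether the sector is isotropic
(`ω̄_f ∈ Ō`) or anisotropic (`ω(f) ∈ O`), the index, and the charge `ε(f) ∈ {+,−}` (`true` = `+`) — the data
on which the constraint functions (2.73), (2.84a), (3.16) depend.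
[cite: BenfattoGiulianiMastropietro2006, §3.1 (3.16) p0022:L1] -/
structure SectorLabel where
  /-- the scale `h(f)` / `j_f` of the sector -/
  scale : ℤ
  /-- isotropic (`true`, `ω̄_f ∈ Ō_{j_f}`) or anisotropic (`false`, `ω(f) ∈ O_{h(f)}`) -/
  iso : Bool
  /-- the sector index -/
  idx : ℕ
  /-- the charge `ε(f)`: `true` = `+`, `false` = `−` -/
  sign : Bool

/-- The s-sector a label designates: `S̄_{j_f,ω̄_f}` if isotropic, `S_{h(f),ω(f)}` if anisotropic ((3.16)).
[cite: BenfattoGiulianiMastropietro2006, §3.1 (3.16) p0022:L1] -/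
def SectorLabel.toSet (γ e₀ μ : ℝ) (eps : ℤ → (Fin 2 → ℝ) → ℝ) (l : SectorLabel) : Set (Fin 2 → ℝ) :=
  if l.iso then sSectorIso γ e₀ μ eps l.scale l.idx else sSector γ e₀ μ eps l.scale l.idx

/-- **The constraint function `χ`** as a proposition ((2.84a) p0016:L78: "`χ(Ω_v^{(j)}) = 𝟙(∀ f ∈ P_v,
∃ k⃗(f) ∈ S_{j_f,ω_f} : Σ_{f∈P_v} ε(f) k⃗(f) = 0⃗)`"; the mixed isotropic/anisotropic form (3.16) p0022:L1–5; the
original (2.73) p0015:L22 for anisotropic labels of one scale): there exist momenta in the prescribed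
s-sectors with signed sum EXACTLY zero ("umklapp processes are impossible if `|P_v| ≤ 8`", Lemma 2.1 (3),
at `μ_BGM < (2−√2)/2`; (2.73) moreover sets `χ := 1` when `|P_v| ≥ 10` — that convention belongs to the
sector sums of §2.8 (t1's file) and is NOT built in here). [cite: BenfattoGiulianiMastropietro2006, §2.8 (2.84a) p0016:L78] -/
def chi (γ e₀ μ : ℝ) (eps : ℤ → (Fin 2 → ℝ) → ℝ) {L : ℕ} (Ω : Fin L → SectorLabel) : Prop :=
  ∃ k : Fin L → (Fin 2 → ℝ), (∀ i, k i ∈ (Ω i).toSet γ e₀ μ eps) ∧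
    ∑ i, (if (Ω i).sign then k i else -k i) = 0

/-! ### App. A3: the Sector Counting Lemma A3.1 (FACT-LIST F-011) -/

/-- **Lemma A3.1 (Sector Counting Lemma)** (p0036:L144–p0037:L2; FACT-LIST F-011, row BGM06.A3.1). *"Let
`h', h, L` be integers such that `h' ≤ h ≤ 0` and `L ≥ 4`. Given `ω_1^{(h')}, …, ω_L^{(h')} ∈ O_{h'}` and
`ω_2^{(h)}, …, ω_L^{(h)} ∈ O_h`, let us define `Ω_L^{(h')} = {ω_i^{(h')}}_{i=1}^L`, `Ω^{(h')}_{L−1} = {ω_i^{(h')}}_{i=2}^L` and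
`Ω^{(h)}_{L−1} = {ω_i^{(h)}}_{i=2}^L`. Then, for any choice of `ω_1^{(h')}`, it is
`Σ_{Ω_{L−1}^{(h')} ≺ Ω_{L−1}^{(h)}} χ(Ω_L^{(h')}) ≤ c^L γ^{½(h−h')(L−3)}` (A3.1), uniformly in `ω_1^{(h')}` and in `Ω^{(h)}_{L−1}`."*
Typed with `L = m + 1` (`m ≥ 3` summed indices `ω_2, …, ω_L`; no natural subtraction): for every charge
assignment `sgn`, every fixed first index `ω₁ < |O_{h'}|` and every coarse assignment `ωc` of scale-`h`
indices, the number (`Set.ncard`; the set is finite) of scale-`h'` ANISOTROPIC index tuples `ω' : Fin m → ℕ`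
(`ω' i ≺ ωc i`) such that the s-sectors of `(ω₁, ω')` admit momenta with signed sum zero is
`≤ c^L γ^{(h−h')(L−3)/2}` (real power). The
standing assumptions of App. A3 are those of §2.4/§3 (the curve of `eps h'` is `C²`, convex, "changing step
by step of `O(|U||h|γ^{2h})`", p0037:L7–9; BGM prove it by adapting [BGM03] §7, Lemmas 7.1/7.5 re-proved on
p0037–p0038); as everywhere in this wave the statement is a predicate on `(γ,e₀,μ,eps,c)`, assumed for BGM's
instance, never asserted. [cite: BenfattoGiulianiMastropietro2006, Lemma A3.1 p0036:L144] -/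
def LemmaA31 (γ e₀ μ : ℝ) (eps : ℤ → (Fin 2 → ℝ) → ℝ) (c : ℝ) : Prop :=
  ∀ (h' h : ℤ) (m : ℕ), h' ≤ h → h ≤ 0 → 3 ≤ m →
    ∀ (sgn : Fin (m + 1) → Bool) (ω₁ : ℕ) (ωc : Fin m → ℕ),
      ω₁ < anisoCount h' → (∀ i, ωc i < anisoCount h) →
        (({ω' : Fin m → ℕ | (∀ i, ω' i < anisoCount h') ∧ (∀ i, Refines h' h (ω' i) (ωc i)) ∧
            chi γ e₀ μ eps (fun i : Fin (m + 1) =>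
              (⟨h', false, (Fin.cons ω₁ ω' : Fin (m + 1) → ℕ) i, sgn i⟩ : SectorLabel))}.ncard : ℕ) : ℝ) ≤
          c ^ (m + 1) * γ ^ (((h - h' : ℤ) : ℝ) * (((m + 1 : ℕ) : ℝ) - 3) / 2)

/-! ### App. A2: the set `A_h(ω̄₁; ω̄₂, ω̄₃, ω̄₄)` of Lemma 3.1 (TREE: bound cited, set typed) -/

/-- **`A_h(ω̄₁; ω̄₂,ω̄₃,ω̄₄)`** (App. A2 p0035:L122–128): "the set of sequences `(ω̄₂,ω̄₃,ω̄₄) ∈ Ō_h × Ō_h × Ō_h` such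
that there exists a sequence of vectors `(k⃗₁,k⃗₂,k⃗₃,k⃗₄)` s.t. `k⃗_i ∈ S̄_{h,ω̄_i}` and `Σ_{i=1}^4 k⃗_i = 0⃗`" (all four
charges `+` as printed; the Cooper pattern `k₁−k₂+k₃−k₄` is equivalent by the reflection symmetry of the
curve). Its cardinality bound `|A_h| ≤ Cγ^{−h}|h|` (A2.0) = Lemma 3.1 (3.23) is PROVED in the tree in the form
`count_pairs_exists` (module `HubbardBandSectorCountingCounts`; see the module doc for the exact statement,
the constant map and the coverage caveat) and is NOT restated as a fact.
[cite: BenfattoGiulianiMastropietro2006, App. A2 (A2.0) p0035:L122] -/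
def isoQuadruples (γ e₀ μ : ℝ) (eps : ℤ → (Fin 2 → ℝ) → ℝ) (h : ℤ) (ω₁ : ℕ) : Set (Fin 3 → ℕ) :=
  {ω | (∀ i, ω i < isoCount h) ∧
    chi γ e₀ μ eps (Fin.cons (⟨h, true, ω₁, true⟩ : SectorLabel)
      (fun i : Fin 3 => (⟨h, true, ω i, true⟩ : SectorLabel)))}

/-! ### App. A1: the ultraviolet integration — (A1.1)–(A1.3), (A1.6), and its result (2.16) (FACT-LIST F-010) -/

/-- **The `k₀`-slice cutoffs `h_n(k₀)` of (A1.2)** (p0035:L11–13), `n ≥ 0`, built from the smooth support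
function `H₀` of (2.9) (the tree's `gnCutoff γ e₀`; `gnScaleCutoff γ e₀ m t = H₀(γ^{−m}t)`, `gnShell`):
`h₀(k₀) = H₀(|k₀|)` and, for `n ≥ 1`, `h_n(k₀) = H₀(γ^{−n}|k₀|) − H₀(γ^{−n+1}|k₀|)` = `gnShell γ e₀ n |k₀|`, so
that `Σ_{n=0}^N h_n(k₀) = H₀(γ^{−N}|k₀|) ↑ 1` and `g^{[1,N]} → g^{(+1)}` ((A1.1), "`lim_{N→∞} g^{[1,N]} = g^{(+1)}`").
PRINT ORIENTATION: (A1.2) as rendered reads "`h_n(k₀) = H₀(γ^{−n+1}|k₀|) − H₀(γ^{−n}|k₀|)`", which for the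
DECREASING `H₀` of (2.9) is `≤ 0` and does not telescope to the ultraviolet region; we type the orientation
under which (A1.1) holds and flag the transposition (referee: rule). The slice propagator is then (A1.2)
`g^{(1,n)}(x) = (L²β)⁻¹ Σ_{k∈𝒟_{β,L}} f₁(k) h_n(k₀) e^{−ikx}/(−ik₀ + ε₀(k⃗) − μ)` (not constructed here; the tree's
`FreqMomentum`/`hubbardCovariance` is the home for it — TODO(concrete)).
[cite: BenfattoGiulianiMastropietro2006, App. A1 (A1.2) p0035:L11] -/
def uvSlice (γ e₀ : ℝ) (n : ℕ) (k₀ : ℝ) : ℝ :=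
  if n = 0 then gnCutoff γ e₀ |k₀| else gnShell γ e₀ (n : ℤ) |k₀|

/-- **(A1.3), the decay of the ultraviolet slice propagators** (p0035:L17–20): "for any integer `K ≥ 0`,
`|g^{(1,n)}(x)| ≤ C_K / (1 + (γⁿ|x₀| + |x⃗|)^K)`", as a predicate on a family `g n = g^{(1,n)}` of functions of
`x = (x₀, x⃗)` (`x₀` the imaginary time — on the `β`-torus `|x₀|` is the distance `d_β`, cf. (2.60) — and
`x⃗ ∈ ℝ² ⊇ ℤ²`) and constants `C : ℕ → ℝ`. [cite: BenfattoGiulianiMastropietro2006, App. A1 (A1.3) p0035:L20] -/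
def UVPropDecay (γ : ℝ) (g : ℕ → ℝ × EuclideanSpace ℝ (Fin 2) → ℂ) (C : ℕ → ℝ) : Prop :=
  ∀ (K n : ℕ) (x : ℝ × EuclideanSpace ℝ (Fin 2)),
    ‖g n x‖ ≤ C K / (1 + (γ ^ n * |x.1| + ‖x.2‖) ^ K)

/-- **The combinatorial profile of an ultraviolet tree** `τ ∈ 𝒯_{(k,N),n}` (App. A1 items 1)–4), p0035:L44–60):
order `n`, root scale `k` ("vertices `v` associated to scale labels `k ≤ h_v ≤ N+1`; the root has scale `k`
and all the endpoints have scale `N+1`"), the total number `n^{tad}` of tadpoles ("trivial `c`-vertices `v`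
with `n_v = 1`"), and over the non-endpoint vertices `V`: `h_v`, `h_{v'}` (`v'` immediately preceding `v`),
`n_v` (endpoints following `v`), `n^{tad}_v` (tadpoles following `v`).
[cite: BenfattoGiulianiMastropietro2006, App. A1 p0035:L44] -/
structure UVTreeProfile where
  /-- the order `n` (all endpoints "of type `U`") -/
  n : ℕ
  /-- the root scale `k ≥ 0` -/
  k : ℤ
  /-- `n^{tad}`, the total number of tadpoles on `τ` -/
  ntad : ℕ
  /-- the non-endpoint vertices -/
  V : Finset ℕ
  /-- `h_v` -/
  scale : ℕ → ℤ
  /-- `h_{v'}` -/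
  predScale : ℕ → ℤ
  /-- `n_v`, the number of endpoints following `v` -/
  nv : ℕ → ℕ
  /-- `n^{tad}_v`, the number of tadpoles following `v` -/
  ntadv : ℕ → ℕ

/-- **(A1.6), the dimensional bound of an ultraviolet tree** (p0035:L68–80): as a predicate on a family of
UV tree profiles and the values `W i l = (L²β)⁻¹ ∫dx₁⋯dx_{2l} |W^{(k,N)}_{2l}(τ_i; x₁,σ₁,ε₁;…)|`:
`W ≤ Cⁿ|U|ⁿ γ^{−k(n−1+n^{tad})} Π_{v not e.p.} γ^{−(h_v−h_{v'})(n_v−1+n^{tad}_v)}` ("the 'internal dimensions'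
`(n_v − 1 + n^{tad}_v)` are all `> 1`, so that the sum over `τ` … gives rise to an exponentially convergent sum
and the bound like (2.16) follows", p0035:L96–98). [cite: BenfattoGiulianiMastropietro2006, App. A1 (A1.6) p0035:L75] -/
def BoundA16 {ι : Type*} (γ U C : ℝ) (𝒯 : ι → UVTreeProfile) (W : ι → ℕ → ℝ) : Prop :=
  ∀ (i : ι) (l : ℕ), W i l ≤
    C ^ (𝒯 i).n * |U| ^ (𝒯 i).n * γ ^ (-((𝒯 i).k * (((𝒯 i).n : ℤ) - 1 + (𝒯 i).ntad))) *
      ∏ v ∈ (𝒯 i).V, γ ^ (-(((𝒯 i).scale v - (𝒯 i).predScale v) *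
        ((((𝒯 i).nv v : ℤ) - 1 + (𝒯 i).ntadv v))))

/-- **The tadpole Remark of App. A1** (p0035:L88–94): "a parity cancellation implies that the tadpole
contribution associated to the subtree rooted on a trivial `c`-vertex `v` of scale `h_v` with `n_v = 1` can be
bounded by `Cγ^{−h_v}` (instead of the naive dimensional bound `C`)" — as a predicate on the scale-indexed sup
`tad h_v` of those contributions (the ultraviolet analogue of Lemma 2.2a's oddity gain, p1's E.2 mechanism).
[cite: BenfattoGiulianiMastropietro2006, App. A1 Remark p0035:L88] -/
def TadpoleGain (γ C : ℝ) (tad : ℤ → ℝ) : Prop :=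
  ∀ hv : ℤ, 0 ≤ hv → tad hv ≤ C * γ ^ (-hv)

/-- **App. A1's result = (2.16)** (statement p0006:L148–156, "the proof of (2.16) is … sketched in Appendix A1";
FACT-LIST F-010, row BGM06.A1). *"For each fixed `M`, the kernels `W^{(0)}_{2l}` vanish for `l` large enough;
moreover they are translation invariant and are given, in the limit `M = +∞`, by power series in `U`,
convergent under the condition `|U| ≤ U₀`, for `U₀` small enough; finally, if `|U| ≤ U₀`, they satisfy the
bounds `∫dx₁⋯dx_{2l} [Π_{1≤i<j≤2l} |x_i−x_j|^{m_ij}] |W^{(0)}_{2l}(x₁,…,x_{2l})| ≤ L²β C_m^l |U|^{max{1,l/2}}` (2.16)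
for some constant `C_m > 0`, where `m = Σ_{i<j} m_ij`."* Typed: the bound (2.16) for the weighted norms
`wNorm U l m` (the sup over weight patterns `{m_ij}` of total degree `m` of the left-hand side, at coupling `U`),
for all `|U| ≤ U₀`, `l ≥ 1`, with constants `C : ℕ → ℝ` and the real exponent `max{1, l/2}`. NOT typed (no
carrier at this level; recorded): spin-independence / translation invariance of the kernels and the
ANALYTICITY clause "power series in `U` convergent for `|U| ≤ U₀`" (the tree proves the elementary
high-temperature analogue, `HubbardHighTemperatureAnalytic`). [cite: BenfattoGiulianiMastropietro2006, §2.2 (2.16) p0006:L152] -/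
def UVIntegration (wNorm : ℝ → ℕ → ℕ → ℝ) (Lside β U₀ : ℝ) (C : ℕ → ℝ) : Prop :=
  ∀ (U : ℝ) (l m : ℕ), |U| ≤ U₀ → 1 ≤ l →
    wNorm U l m ≤ Lside ^ 2 * β * C m ^ l * |U| ^ (max 1 ((l : ℝ) / 2))

end BGM2006AppA

end Literature.MathematicalPhysics.QuantumLattice.FermiRG
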